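import Literature.Topology.FourManifolds.OneJetTransversality
import Literature.Topology.FourManifolds.IntrinsicFoldCriterion
import Literature.Topology.FourManifolds.NormalRetraction
import Mathlib.Geometry.Manifold.WhitneyEmbedding
import HarnessLib

/-!
# First-order generic maps exist on every closed 4-manifold: almost every linear projection of a
# Whitney embedding is 1-jet-transverse with nowhere-vanishing differential (Thom)

Topic `Literature/Topology/FourManifolds` (programme of the fact
`Literature.Topology.FourManifolds.exists_isSimplifiedBrokenLefschetzFibration`, Baykur–Saeki 2017: the
printed proof of Thm. 6.1 starts (§6, p. 19) from *"a generic map `X → S²`"*, whose existence is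
*"a special case of Thom's transversality"* (§2.1, p. 6, citing Levine [Lev0], Thom [T],
Whitney [Wh])).  `OneJetTransversality.lean` proved the first-order layer of that genericity for
maps between vector spaces: for `f : ℝ⁴ ⊇ Ω → ℝ²` and almost every linear `A`, `f + A` has
`d(f + A) ≠ 0` everywhere and is 1-jet-transverse (`OneJet.IsOneJetTransverseAt`, Golubitsky–
Guillemin VI Def. 1.5 / Prop. 3.7).  This file globalises it to a compact boundaryless `C^∞`
4-manifold `M`, following the finite-dimensional proof of Thom's theorem (Golubitsky–Guillemin
1973, Ch. II §4, proof of Thm. 4.9: perturb inside a finite-dimensional family of maps which is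
rich enough at every point; here, as in Milnor's and Guillemin–Pollack's proofs of the easy
transversality theorems, the family of LINEAR PROJECTIONS `x ↦ f₀ x + A(ι x)` of a Whitney
embedding `ι : M ↪ ℝᴺ`, Guillemin–Pollack Ch. 2 §3):

* `OneJet.IsOneJetTransverseAt.congr_of_eventuallyEq`, `OneJet.isOneJetTransverseAt_comp_iff`
  — 1-jet transversality depends only on the 2-jet and is **invariant under reparametrisation of
  the source by a local diffeomorphism** (second-order chain rule,
  `fderiv_fderiv_comp_apply_eq_add`: on `Ker d(g ∘ θ)` the extra term `dg(D²θ(v, k))` is killed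
  by every cokernel covector), so that the condition read in one chart of a manifold holds in
  every chart;
* `OneJet.ae_oneGeneric_comp` — the Euclidean theorem for the family `f + A ∘ h` with `h` an
  IMMERSION `ℝ⁴ ⊇ Ω → ℝᴺ` (the directions `x ↦ B(h x)`, `B ∈ Hom(ℝᴺ, ℝ²)`, have differentials
  `B ∘ dh_x`, which exhaust `Hom(ℝ⁴, ℝ²)` because `dh_x` has a left inverse);
* **`OneJet.ae_oneGeneric_manifold`** — for a compact boundaryless `C^∞` manifold `M` modelled
  on `ℝ⁴`, a `C^∞` map `ι : M → ℝᴺ` with injective differential, a `C^∞` map `f₀ : M → ℝ²` and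
  ANY additive Haar measure on `Hom(ℝᴺ, ℝ²)`: **for almost every `A` the map `f = f₀ + A ∘ ι`
  has, at EVERY point `q ∈ M`, non-zero differential and 1-jet-transverse chart representative
  `f ∘ φ_q⁻¹` at `φ_q(q)`** (finite subcover by charts, the Euclidean theorem in each, and the
  invariance above to pass from the finitely many charts to the chart at `q`);
* **`OneJet.exists_oneGeneric_map`** — hence (Whitney embedding, Mathlib's
  `exists_embedding_euclidean_of_compact`) **every compact boundaryless `C^∞` 4-manifold carries
  a `C^∞` map to `ℝ²` which is first-order generic at every point**: rank `≥ 1` everywhere and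
  `j¹f ⋔ S₁` at every critical point — the first-order part of Baykur–Saeki's "generic map"
  (by `OneJetCriticalCurve.lean` its critical set is then a closed 1-dimensional submanifold,
  i.e. finitely many circles, and by `OneJetFoldDichotomy.lean` each critical point is a fold
  point or a cusp candidate).

Everything here is proved; no definitions, no named facts (D-0026).  Not here: the second-order
genericity (cusp candidates are simple cusps, isolated), maps to `S²` rather than `ℝ²` (compose
with a chart of `S²`; irrelevant for Cor. 6.2), and the normal forms.

## References

* M. Golubitsky, V. Guillemin, *Stable Mappings and Their Singularities*, GTM 14 (1973), Ch. II
  §4, Thm. 4.9 and its proof; Ch. VI §1, Def. 1.5; Ch. VI §3, Prop. 3.7.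
  [GolubitskyGuillemin1973]
* V. Guillemin, A. Pollack, *Differential Topology* (1974), Ch. 2 §3 (transversality by linear
  perturbation of an embedded manifold). [GuilleminPollack2010]
* R. İ. Baykur, O. Saeki, *Simplifying indefinite fibrations on 4-manifolds*, arXiv:1705.11169,
  §2.1 p. 6, §6 p. 19. [BaykurSaeki2017]
-/

noncomputable section

open Set Function Filter MeasureTheory Module
open scoped ContDiff Topology Manifold

namespace Literature.Topology.FourManifolds

namespace OneJet

open Literature.Topology.FourManifolds.CerfPath (lin lin_apply)

/-! ### Invariance: the condition depends on the 2-jet and not on the parametrisation -/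

section Invariance

variable {E E' F : Type} [NormedAddCommGroup E] [NormedSpace ℝ E] [NormedAddCommGroup E']
  [NormedSpace ℝ E'] [NormedAddCommGroup F] [NormedSpace ℝ F]

/-- 1-jet transversality at `x` only depends on the germ of the map at `x`. [folklore] -/
theorem IsOneJetTransverseAt.congr_of_eventuallyEq {g₁ g₂ : E → F} {x : E}
    (h : IsOneJetTransverseAt g₁ x) (heq : g₁ =ᶠ[𝓝 x] g₂) : IsOneJetTransverseAt g₂ x := by
  intro ℓ hℓ hcomp k hk hv
  have h1 : fderiv ℝ g₂ x = fderiv ℝ g₁ x := heq.symm.fderiv_eq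
  have h2 : fderiv ℝ (fderiv ℝ g₂) x = fderiv ℝ (fderiv ℝ g₁) x := heq.symm.fderiv.fderiv_eq
  rw [h1] at hcomp hk
  rw [h2] at hv
  exact h ℓ hℓ hcomp k hk hv

/-- Germ invariance, as an iff. [folklore] -/
theorem isOneJetTransverseAt_congr_of_eventuallyEq {g₁ g₂ : E → F} {x : E}
    (heq : g₁ =ᶠ[𝓝 x] g₂) : IsOneJetTransverseAt g₁ x ↔ IsOneJetTransverseAt g₂ x :=
  ⟨fun h => h.congr_of_eventuallyEq heq, fun h => h.congr_of_eventuallyEq heq.symm⟩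

/-- **1-jet transversality is invariant under reparametrisation of the source**: if `θ` is `C²`
at `x` with invertible differential `A` and `g` is `C²` at `θ x`, then `g ∘ θ` is
1-jet-transverse at `x` iff `g` is at `θ x`.  By the second-order chain rule
`D²(g ∘ θ)(x)(v, k) = dg(D²θ(x)(v, k)) + D²g(θ x)(A v, A k)`; for `k ∈ Ker d(g ∘ θ)_x = A⁻¹ Ker dg`
and a cokernel covector `ℓ` the first term is killed, so the pairings correspond under `A`
(Golubitsky–Guillemin VI §3: the intrinsic derivative is intrinsic).
[cite: GolubitskyGuillemin1973, Ch. VI §3, Props. 3.6–3.7] -/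
theorem isOneJetTransverseAt_comp_iff {g : E → F} {θ : E' → E} {x : E'} (A : E' ≃L[ℝ] E)
    (hθ : HasFDerivAt θ (A : E' →L[ℝ] E) x) (hθ2 : ContDiffAt ℝ 2 θ x)
    (hg2 : ContDiffAt ℝ 2 g (θ x)) :
    IsOneJetTransverseAt (g ∘ θ) x ↔ IsOneJetTransverseAt g (θ x) := by
  have hgd : DifferentiableAt ℝ g (θ x) := hg2.differentiableAt (by simp)
  have hfd : fderiv ℝ (g ∘ θ) x = (fderiv ℝ g (θ x)).comp (A : E' →L[ℝ] E) := by
    rw [fderiv_comp x hgd hθ.differentiableAt, hθ.fderiv]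
  have hAθ : fderiv ℝ θ x = (A : E' →L[ℝ] E) := hθ.fderiv
  -- the second-order chain rule, paired with a cokernel covector
  have hchain : ∀ (ℓ : F →L[ℝ] ℝ), ℓ.comp (fderiv ℝ g (θ x)) = 0 → ∀ v k : E',
      ℓ (fderiv ℝ (fderiv ℝ (g ∘ θ)) x v k) = ℓ (fderiv ℝ (fderiv ℝ g) (θ x) (A v) (A k)) := by
    intro ℓ hℓ v k
    rw [fderiv_fderiv_comp_apply_eq_add hg2 hθ2 v k, map_add, hAθ]
    have : ℓ (fderiv ℝ g (θ x) (fderiv ℝ (fderiv ℝ θ) x v k)) = 0 := by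
      simpa using congrArg (fun φ : E →L[ℝ] ℝ => φ (fderiv ℝ (fderiv ℝ θ) x v k)) hℓ
    rw [this, zero_add]
    rfl
  constructor
  · intro h ℓ hℓ hcomp k hk hv
    -- pull back `k` and the test vectors by `A`
    have hcomp' : ℓ.comp (fderiv ℝ (g ∘ θ) x) = 0 := by
      rw [hfd, ← ContinuousLinearMap.comp_assoc, hcomp, ContinuousLinearMap.zero_comp]
    have hk' : fderiv ℝ (g ∘ θ) x (A.symm k) = 0 := by
      rw [hfd, ContinuousLinearMap.comp_apply]
      simpa using hk
    have hv' : ∀ v', ℓ (fderiv ℝ (fderiv ℝ (g ∘ θ)) x v' (A.symm k)) = 0 := fun v' => by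
      rw [hchain ℓ hcomp v' (A.symm k)]
      simpa using hv (A v')
    have := h ℓ hℓ hcomp' (A.symm k) hk' hv'
    simpa using congrArg A this
  · intro h ℓ hℓ hcomp k hk hv
    have hcomp' : ℓ.comp (fderiv ℝ g (θ x)) = 0 := by
      rw [hfd, ← ContinuousLinearMap.comp_assoc] at hcomp
      ext u
      have := congrArg (fun φ : E' →L[ℝ] ℝ => φ (A.symm u)) hcomp
      simpa using this
    have hk' : fderiv ℝ g (θ x) (A k) = 0 := by
      rw [hfd, ContinuousLinearMap.comp_apply] at hk
      exact hk
    have hv' : ∀ v, ℓ (fderiv ℝ (fderiv ℝ g) (θ x) v (A k)) = 0 := fun v => by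
      have := hv (A.symm v)
      rw [hchain ℓ hcomp' (A.symm v) k] at this
      simpa using this
    have := h ℓ hℓ hcomp' (A k) hk' hv'
    simpa using congrArg A.symm this

end Invariance

/-! ### The Euclidean theorem for the projections of an immersion -/

section Immersion

variable {E G F : Type} [NormedAddCommGroup E] [NormedSpace ℝ E] [FiniteDimensional ℝ E]
  [NormedAddCommGroup G] [NormedSpace ℝ G] [FiniteDimensional ℝ G]
  [NormedAddCommGroup F] [NormedSpace ℝ F] [FiniteDimensional ℝ F]

omit [FiniteDimensional ℝ E] [FiniteDimensional ℝ F] in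
/-- An injective linear map between finite-dimensional spaces has a continuous linear left
inverse. [folklore] -/
theorem exists_clm_leftInverse {T : E →L[ℝ] G} (hT : Injective T) :
    ∃ L : G →L[ℝ] E, ∀ v, L (T v) = v := by
  obtain ⟨L, hL⟩ := (T : E →ₗ[ℝ] G).exists_leftInverse_of_injective (LinearMap.ker_eq_bot.2 hT)
  refine ⟨LinearMap.toContinuousLinearMap L, fun v => ?_⟩
  have := congrArg (fun φ : E →ₗ[ℝ] E => φ v) hL
  simpa using this

omit [FiniteDimensional ℝ E] [FiniteDimensional ℝ F] in
/-- **The projections of an immersion form a rich family**: if `T = dh_x` is injective and `b` is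
a basis of `Hom(G, F)`, the differentials `bᵢ ∘ T` of the directions `x ↦ bᵢ (h x)` span
`Hom(E, F)`. [cite: GuilleminPollack2010, Ch. 2 §3] -/
theorem surjective_lin_basis_comp {κ : Type} [Fintype κ] (b : Basis κ ℝ (G →L[ℝ] F))
    {T : E →L[ℝ] G} (hT : Injective T) : Surjective (lin fun i => (b i).comp T) := by
  obtain ⟨L, hL⟩ := exists_clm_leftInverse hT
  intro N
  refine ⟨b.equivFun (N.comp L), ?_⟩
  rw [lin_apply]
  have h : ∑ i, b.equivFun (N.comp L) i • (b i).comp T = (∑ i, b.equivFun (N.comp L) i • b i).comp T := by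
    rw [ContinuousLinearMap.finsetSum_comp]
    refine Finset.sum_congr rfl fun i _ => ?_
    rw [ContinuousLinearMap.smul_comp]
  rw [h, b.sum_equivFun]
  ext v
  simp [hL v]

/-- **First-order genericity for the projections of an immersion** (the Euclidean theorem of
`OneJetTransversality.lean` for the family `x ↦ f x + A(h x)`).  Let `f : E → F` and
`h : E → G` be `C^∞` on the open set `Ω`, `dh_x` injective at every `x ∈ Ω` and
`dim E < dim Hom(E, F)`.  Then for almost every linear `A : G → F` (any additive Haar measure
on `Hom(G, F)`) the map `f + A ∘ h` has nowhere-vanishing differential on `Ω` and is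
1-jet-transverse at every point of `Ω`.
[cite: GolubitskyGuillemin1973, Ch. II §4, Thm. 4.9; Ch. VI §1, Def. 1.5] [cite: GuilleminPollack2010, Ch. 2 §3] -/
theorem ae_oneGeneric_comp (μ : Measure (G →L[ℝ] F)) [μ.IsAddHaarMeasure]
    {f : E → F} {h : E → G} {Ω : Set E} (hΩ : IsOpen Ω) (hf : ContDiffOn ℝ ∞ f Ω)
    (hh : ContDiffOn ℝ ∞ h Ω) (hinj : ∀ x ∈ Ω, Injective (fderiv ℝ h x))
    (hdim : finrank ℝ E < finrank ℝ (E →L[ℝ] F)) :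
    ∀ᵐ A ∂μ, ∀ x ∈ Ω, fderiv ℝ (fun y => f y + A (h y)) x ≠ 0 ∧
      IsOneJetTransverseAt (fun y => f y + A (h y)) x := by
  set b := Module.finBasis ℝ (G →L[ℝ] F) with hb
  set T : (G →L[ℝ] F) ≃L[ℝ] (Fin (finrank ℝ (G →L[ℝ] F)) → ℝ) := b.equivFunL with hT
  haveI : (Measure.map T μ).IsAddHaarMeasure := T.isAddHaarMeasure_map μ
  -- the directions `x ↦ bᵢ (h x)` and their differentials `bᵢ ∘ dh_x`
  set w : Fin (finrank ℝ (G →L[ℝ] F)) → E → F := fun i y => b i (h y) with hw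
  have hws : ∀ i, ContDiffOn ℝ ∞ (w i) Ω := fun i => (b i).contDiff.comp_contDiffOn hh
  have hwd : ∀ i, ∀ x ∈ Ω, fderiv ℝ (w i) x = (b i).comp (fderiv ℝ h x) := by
    intro i x hx
    have hhd : HasFDerivAt h (fderiv ℝ h x) x :=
      ((hh.contDiffAt (hΩ.mem_nhds hx)).differentiableAt (by simp)).hasFDerivAt
    exact ((b i).hasFDerivAt.comp x hhd).fderiv
  have hspan : ∀ x ∈ Ω, Surjective (lin fun i => fderiv ℝ (w i) x) := by
    intro x hx
    have : (fun i => fderiv ℝ (w i) x) = fun i => (b i).comp (fderiv ℝ h x) :=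
      funext fun i => hwd i x hx
    rw [this]
    exact surjective_lin_basis_comp b (hinj x hx)
  have hae := ae_oneGeneric_perturb (Measure.map T μ) hΩ hf hws hspan hdim
  have hae' := ae_of_ae_map T.continuous.measurable.aemeasurable hae
  filter_upwards [hae'] with A hA
  have heq : perturb f w (T A) = fun y => f y + A (h y) := by
    funext y
    rw [perturb_apply]
    congr 1
    have hsum := congrArg (fun B : G →L[ℝ] F => B (h y)) (b.sum_equivFun A)
    simp only [_root_.sum_apply, _root_.smul_apply] at hsum
    rw [hT]
    exact hsum
  rw [heq] at hA
  exact hA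

end Immersion

/-! ### Closed 4-manifolds: almost every projection of an embedding is first-order generic -/

section Manifold

/-- Local notation for this file: the model space `ℝⁿ = EuclideanSpace ℝ (Fin n)`. -/
local notation "𝔼 " n:arg => EuclideanSpace ℝ (Fin n)

variable {M : Type*} [TopologicalSpace M] [ChartedSpace (𝔼 4) M] [IsManifold (𝓡 4) ∞ M]

omit [IsManifold (𝓡 4) ∞ M] in
/-- The chart representative in the chart at `p` of a sum `f₀ + A ∘ ι`. [folklore] -/
theorem comp_extChartAt_symm_add {n : ℕ} (f₀ : M → 𝔼 2) (ι : M → 𝔼 n)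
    (A : (𝔼 n) →L[ℝ] 𝔼 2) (p : M) :
    ((fun x => f₀ x + A (ι x)) ∘ (extChartAt (𝓡 4) p).symm) =
      fun y => (f₀ ∘ (extChartAt (𝓡 4) p).symm) y + A ((ι ∘ (extChartAt (𝓡 4) p).symm) y) :=
  rfl

/-- **The chart transition at a point of a common chart domain, packaged**: for `q` in the chart
domain of `p`, the transition `θ = φ_p ∘ φ_q⁻¹` is `C^∞` near `φ_q q` with an invertible
derivative there, maps `φ_q q` to `φ_p q`, and every chart representative at `q` is, near
`φ_q q`, the representative at `p` composed with `θ`. [folklore] -/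
theorem exists_transition {p q : M} (hq : q ∈ (chartAt (𝔼 4) p).source) :
    ∃ (θ : (𝔼 4) → 𝔼 4) (A : (𝔼 4) ≃L[ℝ] 𝔼 4),
      θ (extChartAt (𝓡 4) q q) = extChartAt (𝓡 4) p q ∧
      ContDiffAt ℝ ∞ θ (extChartAt (𝓡 4) q q) ∧
      HasFDerivAt θ (A : (𝔼 4) →L[ℝ] 𝔼 4) (extChartAt (𝓡 4) q q) ∧
      ∀ {V : Type} (F : M → V),
        (F ∘ (extChartAt (𝓡 4) q).symm) =ᶠ[𝓝 (extChartAt (𝓡 4) q q)]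
          ((F ∘ (extChartAt (𝓡 4) p).symm) ∘ θ) := by
  set Θ : PartialEquiv (𝔼 4) (𝔼 4) :=
    (𝓡 4).extendCoordChange (chartAt (𝔼 4) q) (chartAt (𝔼 4) p) with hΘ
  have hy₀ : extChartAt (𝓡 4) q q ∈ Θ.source := by
    rw [hΘ, ModelWithCorners.extendCoordChange_source]
    refine ⟨chartAt (𝔼 4) q q, ?_, rfl⟩
    simp only [OpenPartialHomeomorph.trans_source, OpenPartialHomeomorph.symm_source, mem_inter_iff,
      mem_preimage]
    refine ⟨mem_chart_target _ q, ?_⟩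
    rw [(chartAt (𝔼 4) q).left_inv (mem_chart_source _ q)]
    exact hq
  have hΘo : IsOpen Θ.source := by
    rw [hΘ, ModelWithCorners.extendCoordChange_source]
    have : ((𝓡 4) : (𝔼 4) → 𝔼 4) = id := by ext x i; rfl
    rw [this, image_id]
    exact ((chartAt (𝔼 4) q).symm ≫ₕ chartAt (𝔼 4) p).open_source
  have hΘs : ContDiffOn ℝ ∞ Θ Θ.source :=
    (𝓡 4).contDiffOn_extendCoordChange (IsManifold.chart_mem_maximalAtlas q)
      (IsManifold.chart_mem_maximalAtlas p)
  have hΘc : ContDiffAt ℝ ∞ Θ (extChartAt (𝓡 4) q q) := hΘs.contDiffAt (hΘo.mem_nhds hy₀)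
  have hinv := (𝓡 4).isInvertible_fderivWithin_extendCoordChange (n := ∞) (by simp)
    (IsManifold.chart_mem_maximalAtlas q) (IsManifold.chart_mem_maximalAtlas p) hy₀
  rw [fderivWithin_of_isOpen hΘo hy₀] at hinv
  obtain ⟨A, hA⟩ := hinv
  have hΘd : HasFDerivAt Θ (A : (𝔼 4) →L[ℝ] 𝔼 4) (extChartAt (𝓡 4) q q) := by
    rw [hA]
    exact (hΘc.differentiableAt (by simp)).hasFDerivAt
  refine ⟨Θ, A, ?_, hΘc, hΘd, fun F => ?_⟩
  · -- `θ (φ_q q) = φ_p q`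
    change extChartAt (𝓡 4) p ((extChartAt (𝓡 4) q).symm (extChartAt (𝓡 4) q q)) = _
    rw [extChartAt_to_inv]
  · -- the representatives agree near `φ_q q`
    have hsymm : ContinuousAt (extChartAt (𝓡 4) q).symm (extChartAt (𝓡 4) q q) :=
      continuousAt_extChartAt_symm q
    have hmem : ∀ᶠ y in 𝓝 (extChartAt (𝓡 4) q q),
        (extChartAt (𝓡 4) q).symm y ∈ (chartAt (𝔼 4) p).source := by
      refine hsymm.preimage_mem_nhds ?_
      rw [extChartAt_to_inv]
      exact (chartAt (𝔼 4) p).open_source.mem_nhds hq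
    filter_upwards [hmem] with y hy
    change F ((extChartAt (𝓡 4) q).symm y) =
      F ((extChartAt (𝓡 4) p).symm (extChartAt (𝓡 4) p ((extChartAt (𝓡 4) q).symm y)))
    rw [(extChartAt (𝓡 4) p).left_inv]
    rwa [extChartAt_source]

/-- **First-order generic maps from almost every projection** (Thom's theorem at first order on a
closed 4-manifold; Golubitsky–Guillemin II Thm. 4.9 with VI Def. 1.5, by the linear-projection
family of Guillemin–Pollack Ch. 2 §3).  Let `M` be a compact boundaryless `C^∞` manifold modelled
on `ℝ⁴`, `ι : M → ℝᴺ` a `C^∞` map with injective differential (e.g. a Whitney embedding),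
`f₀ : M → ℝ²` a `C^∞` map and `μ` an additive Haar measure on `Hom(ℝᴺ, ℝ²)`.  Then for almost
every `A`, the map `f = f₀ + A ∘ ι` has, at every point `q ∈ M`, a chart representative
`f ∘ φ_q⁻¹` with non-zero differential at `φ_q(q)` which is 1-jet-transverse there.
[cite: GolubitskyGuillemin1973, Ch. II §4, Thm. 4.9; Ch. VI §1, Def. 1.5; Ch. VI §3, Prop. 3.7]
[cite: GuilleminPollack2010, Ch. 2 §3] [cite: BaykurSaeki2017, §2.1, p. 6] -/
theorem ae_oneGeneric_manifold [T2Space M] [CompactSpace M] {n : ℕ} {ι : M → 𝔼 n}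
    (hι : ContMDiff (𝓡 4) (𝓡 n) ∞ ι) (hιinj : ∀ x : M, Injective (mfderiv (𝓡 4) (𝓡 n) ι x))
    {f₀ : M → 𝔼 2} (hf₀ : ContMDiff (𝓡 4) (𝓡 2) ∞ f₀)
    (μ : Measure ((𝔼 n) →L[ℝ] 𝔼 2)) [μ.IsAddHaarMeasure] :
    ∀ᵐ A ∂μ, ∀ q : M,
      fderiv ℝ ((fun x => f₀ x + A (ι x)) ∘ (extChartAt (𝓡 4) q).symm) (extChartAt (𝓡 4) q q) ≠ 0 ∧
      IsOneJetTransverseAt ((fun x => f₀ x + A (ι x)) ∘ (extChartAt (𝓡 4) q).symm)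
        (extChartAt (𝓡 4) q q) := by
  -- a finite subcover by chart domains
  obtain ⟨t, ht⟩ := isCompact_univ.elim_finite_subcover (fun p : M => (chartAt (𝔼 4) p).source)
    (fun p => (chartAt (𝔼 4) p).open_source) fun x _ => mem_iUnion.2 ⟨x, mem_chart_source _ x⟩
  -- the Euclidean theorem in each of the finitely many charts
  have hchart : ∀ p : M, ∀ᵐ A ∂μ, ∀ y ∈ (extChartAt (𝓡 4) p).target,
      fderiv ℝ (fun z => (f₀ ∘ (extChartAt (𝓡 4) p).symm) z +
          A ((ι ∘ (extChartAt (𝓡 4) p).symm) z)) y ≠ 0 ∧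
        IsOneJetTransverseAt (fun z => (f₀ ∘ (extChartAt (𝓡 4) p).symm) z +
          A ((ι ∘ (extChartAt (𝓡 4) p).symm) z)) y := by
    intro p
    -- injectivity of the chart derivative of `ι`
    have hinjc : ∀ y ∈ (extChartAt (𝓡 4) p).target,
        Injective (fderiv ℝ (ι ∘ (extChartAt (𝓡 4) p).symm) y) := by
      intro y hy
      have hx : (extChartAt (𝓡 4) p).symm y ∈ (extChartAt (𝓡 4) p).source :=
        (extChartAt (𝓡 4) p).map_target hy
      have h := injective_chartDeriv (I := 𝓡 4) (e := ι) hx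
        ((hι _).mdifferentiableAt (by simp)) (hιinj _)
      rw [(extChartAt (𝓡 4) p).right_inv hy] at h
      exact h
    exact ae_oneGeneric_comp μ (isOpen_extChartAt_target p)
      (contDiffOn_comp_extChartAt_symm_target (I := 𝓡 4) hf₀ p)
      (contDiffOn_comp_extChartAt_symm_target (I := 𝓡 4) hι p) hinjc finrank_euclideanFour_lt
  have hall : ∀ᵐ A ∂μ, ∀ p ∈ t, ∀ y ∈ (extChartAt (𝓡 4) p).target,
      fderiv ℝ (fun z => (f₀ ∘ (extChartAt (𝓡 4) p).symm) z +
          A ((ι ∘ (extChartAt (𝓡 4) p).symm) z)) y ≠ 0 ∧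
        IsOneJetTransverseAt (fun z => (f₀ ∘ (extChartAt (𝓡 4) p).symm) z +
          A ((ι ∘ (extChartAt (𝓡 4) p).symm) z)) y :=
    (eventually_all_finset t).2 fun p _ => hchart p
  filter_upwards [hall] with A hA q
  -- `q` lies in one of the finitely many chart domains
  obtain ⟨p, hpt, hqp⟩ : ∃ p ∈ t, q ∈ (chartAt (𝔼 4) p).source := by
    have := ht (mem_univ q)
    simpa only [mem_iUnion, exists_prop] using this
  set Fm : M → 𝔼 2 := fun x => f₀ x + A (ι x) with hFm
  have hqs : q ∈ (extChartAt (𝓡 4) p).source := by rwa [extChartAt_source]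
  have hy : extChartAt (𝓡 4) p q ∈ (extChartAt (𝓡 4) p).target := (extChartAt (𝓡 4) p).map_source hqs
  obtain ⟨h1, h2⟩ := hA p hpt _ hy
  -- pass from the chart at `p` to the chart at `q` through the transition map
  obtain ⟨θ, L, hθq, hθc, hθd, hθF⟩ := exists_transition (M := M) hqp
  have heq := hθF Fm
  have hgp : ContDiffOn ℝ ∞ (Fm ∘ (extChartAt (𝓡 4) p).symm) (extChartAt (𝓡 4) p).target := by
    rw [hFm, comp_extChartAt_symm_add]
    exact (contDiffOn_comp_extChartAt_symm_target (I := 𝓡 4) hf₀ p).add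
      (A.contDiff.comp_contDiffOn (contDiffOn_comp_extChartAt_symm_target (I := 𝓡 4) hι p))
  have hgp2 : ContDiffAt ℝ 2 (Fm ∘ (extChartAt (𝓡 4) p).symm) (θ (extChartAt (𝓡 4) q q)) := by
    rw [hθq]
    exact (hgp.contDiffAt ((isOpen_extChartAt_target p).mem_nhds hy)).of_le (by norm_cast)
  have hgpd : DifferentiableAt ℝ (Fm ∘ (extChartAt (𝓡 4) p).symm) (θ (extChartAt (𝓡 4) q q)) :=
    hgp2.differentiableAt (by simp)
  refine ⟨?_, ?_⟩
  · -- non-vanishing differential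
    rw [heq.fderiv_eq, fderiv_comp _ hgpd hθd.differentiableAt, hθd.fderiv, hθq]
    intro h0
    apply h1
    rw [← comp_extChartAt_symm_add]
    ext v i
    have := congrArg (fun φ : (𝔼 4) →L[ℝ] 𝔼 2 => φ (L.symm v) i) h0
    simpa using this
  · -- 1-jet transversality
    rw [isOneJetTransverseAt_congr_of_eventuallyEq heq,
      isOneJetTransverseAt_comp_iff L hθd (hθc.of_le (by norm_cast)) hgp2, hθq]
    rw [← comp_extChartAt_symm_add] at h2
    exact h2

/-- **Every compact boundaryless `C^∞` 4-manifold admits a first-order generic map to the plane**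
(Thom, via Golubitsky–Guillemin II Thm. 4.9 / VI Def. 1.5 and the Whitney embedding theorem):
there is a `C^∞` map `f : M → ℝ²` such that at every point `q`, read in the chart at `q`, the
differential of `f` is non-zero (rank `≥ 1`) and `j¹f ⋔ S₁` (`OneJet.IsOneJetTransverseAt`) —
the first-order part of "generic map" in Baykur–Saeki §2.1 (the existence of a generic map
`X → S²` from which the proof of their Thm. 6.1 starts, §6 p. 19).
[cite: BaykurSaeki2017, §2.1 p. 6, §6 p. 19] [cite: GolubitskyGuillemin1973, Ch. II §4, Thm. 4.9; Ch. VI §1, Def. 1.5] -/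
theorem exists_oneGeneric_map (M : Type*) [TopologicalSpace M] [T2Space M] [CompactSpace M]
    [ChartedSpace (𝔼 4) M] [IsManifold (𝓡 4) ∞ M] :
    ∃ f : M → 𝔼 2, ContMDiff (𝓡 4) (𝓡 2) ∞ f ∧ ∀ q : M,
      fderiv ℝ (f ∘ (extChartAt (𝓡 4) q).symm) (extChartAt (𝓡 4) q q) ≠ 0 ∧
      IsOneJetTransverseAt (f ∘ (extChartAt (𝓡 4) q).symm) (extChartAt (𝓡 4) q q) := by
  obtain ⟨n, ι, hι, -, hιinj⟩ := exists_embedding_euclidean_of_compact (I := 𝓡 4) (M := M)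
  -- an additive Haar measure on `Hom(ℝᴺ, ℝ²)`
  set b := Module.finBasis ℝ ((𝔼 n) →L[ℝ] 𝔼 2) with hb
  set T : ((𝔼 n) →L[ℝ] 𝔼 2) ≃L[ℝ] (Fin (finrank ℝ ((𝔼 n) →L[ℝ] 𝔼 2)) → ℝ) := b.equivFunL
    with hT
  set μ : Measure ((𝔼 n) →L[ℝ] 𝔼 2) := Measure.map T.symm volume with hμ
  haveI : μ.IsAddHaarMeasure := T.symm.isAddHaarMeasure_map volume
  have hf₀ : ContMDiff (𝓡 4) (𝓡 2) ∞ (fun _ : M => (0 : 𝔼 2)) := contMDiff_const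
  obtain ⟨A, hA⟩ := (ae_oneGeneric_manifold hι hιinj hf₀ μ).exists
  refine ⟨fun x => (0 : 𝔼 2) + A (ι x), ?_, hA⟩
  exact contMDiff_const.add (A.contDiff.comp_contMDiff hι)

end Manifold

end OneJet

end Literature.Topology.FourManifolds
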